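import Literature.AlgebraicGeometry.Motives.FunctionFieldOver
import HarnessLib

/-!
# Coordinates of rational functions along a finite morphism: `K(Y)`-bases of `K(X)` made of
# regular functions, common denominators, and regularity of coordinates

For a finite dominant morphism `f : X → Y` of integral schemes and a nonempty affine open
`W = Spec A ⊆ Y` with `f⁻¹W = Spec B` (`B` a finite `A`-module), the function field `K(X)` is a
finite-dimensional `K(Y)`-vector space spanned by (the rational functions of) `B`
(`Motives/FunctionFieldOver`). This file supplies the linear algebra over `W` that drives the
cohomology-free comparison of `h⁰(m f^*D)` with `h⁰(m D)` (`Motives/FiniteFlatSandwich`):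

* `FunctionFieldOver.exists_basis_mem_range`: a `K(Y)`-basis `e` of `K(X)` consisting of rational
  functions of sections over `f⁻¹W` (extracted from the spanning set `B`);
* `FunctionFieldOver.exists_denominator`: a **common denominator** `0 ≠ c ∈ A` with
  `c · e^*_l(b) ∈ A` for every `b ∈ B` and every coordinate functional `e^*_l` (the finitely many
  `A`-module generators of `B` have coordinates in `K(Y) = Frac A`);
* `FunctionFieldOver.exists_pow_mul_coord_eq` / `isRegularAt_coord_of_forall_isRegularAt`:
  **regularity of coordinates** — if a rational function `β` on `X` is regular over `f⁻¹(W ∩ V)`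
  then each `c · e^*_l(β)` is regular on `W ∩ V` (on a principal open `D(c') ⊆ W`,
  `Γ(f⁻¹D(c'), 𝒪_X) = B_{c'}`, Görtz–Wedhorn I, (2.10.1), so `c'^N β ∈ B`).

Everything happens inside `K(X)` and `K(Y)` (`FunctionFieldOver f` is `K(X)` with its
`K(Y)`-algebra structure); for a `K`-morphism `f` the coordinate functionals are `K`-linear
(`coord_of_smul`, as `f^♯` is a `K`-algebra map, `RatFn.functionFieldMap_algebraMap`).

Mathlib searched and used: `exists_linearIndependent`, `Module.Basis.mk`,
`Module.Basis.indexEquiv`, `Module.finBasis`, `IsLocalization.exist_integer_multiples_of_finite`,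
`Scheme.preimage_basicOpen`, `IsAffineOpen.exists_basicOpen_le`,
`functionField_isFractionRing_of_isAffineOpen`, `IsFinite.finite_app`; Mathlib has no statement
about function fields of finite covers beyond `Morphisms/FlatRank` (cf. `Motives/FunctionFieldOver`).

## References

* U. Görtz, T. Wedhorn, *Algebraic Geometry I: Schemes*, 2nd ed. (2020),
  doi:10.1007/978-3-658-30733-2: (2.10.1) (`Γ(D(f), 𝒪) = A_f`), Prop. 3.29 (PDF p. 102),
  (12.6) (PDF p. 414: the generic fibre of a finite morphism of integral schemes).
  [GortzWedhorn2020]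
-/

universe u

open CategoryTheory AlgebraicGeometry TopologicalSpace Opposite

noncomputable section

namespace Literature.AlgebraicGeometry.Motives

open RatFn

namespace FunctionFieldOver

variable {X Y : Scheme.{u}} [IsIntegral X] [IsIntegral Y] (f : X ⟶ Y) [IsDominant f]

/-! ### Coordinates and the base field `K` -/

section BaseField

variable (K : Type u) [Field K] [X.Over (Spec (.of K))] [Y.Over (Spec (.of K))]
  [f.IsOver (Spec (.of K))]

/-- For a `K`-morphism `f`, the coordinate functionals of a `K(Y)`-basis of `K(X)` are `K`-linear
on `K(X)`: `e^*_l(κ x) = κ e^*_l(x)` for `κ ∈ K` (`f^♯` is a `K`-algebra map,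
`RatFn.functionFieldMap_algebraMap`, so `κ x = f^♯(κ) x` is the `K(Y)`-scalar action of `κ`).
[folklore] -/
theorem coord_of_smul {ι : Type*} (e : Module.Basis ι Y.functionField (FunctionFieldOver f))
    (l : ι) (κ : K) (x : X.functionField) :
    e.coord l (of f (κ • x)) = κ • e.coord l (of f x) := by
  have h : of f (κ • x) = (algebraMap K Y.functionField κ) • of f x := by
    rw [Algebra.smul_def, ← functionFieldMap_algebraMap K f κ, map_mul, Algebra.smul_def,
      algebraMap_apply]
  rw [h, LinearMap.map_smul, smul_eq_mul, Algebra.smul_def]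

end BaseField

/-! ### A `K(Y)`-basis of `K(X)` of functions regular over an affine open -/

section Basis

variable [IsFinite f] {V : Y.Opens} (hVaff : IsAffineOpen V) (hV : genericPoint Y ∈ V)

include hVaff in
/-- **A `K(Y)`-basis of `K(X)` inside `Γ(f⁻¹V, 𝒪_X)`**: for `f` finite dominant and `V ⊆ Y` a
nonempty affine open, `K(X)` has a `K(Y)`-basis, indexed by `Fin [K(X) : K(Y)]`, consisting of
rational functions of sections over `f⁻¹V` (a basis extracted from the spanning set
`Γ(f⁻¹V, 𝒪_X)`, `span_range_ofPreimageSection_eq_top`). [folklore] -/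
theorem exists_basis_mem_range :
    ∃ e : Module.Basis (Fin (Module.finrank Y.functionField (FunctionFieldOver f)))
      Y.functionField (FunctionFieldOver f), ∀ l, e l ∈ Set.range (ofPreimageSection f hV) := by
  obtain ⟨b, hb, hspan, hli⟩ :=
    exists_linearIndependent Y.functionField (Set.range (ofPreimageSection f hV))
  rw [span_range_ofPreimageSection_eq_top f hVaff hV] at hspan
  let e₀ : Module.Basis b Y.functionField (FunctionFieldOver f) :=
    Module.Basis.mk hli (by rw [Subtype.range_coe, hspan])
  haveI : FiniteDimensional Y.functionField (FunctionFieldOver f) := finiteDimensional f hVaff hV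
  let σ := e₀.indexEquiv (Module.finBasis Y.functionField (FunctionFieldOver f))
  refine ⟨e₀.reindex σ, fun l => ?_⟩
  rw [Module.Basis.reindex_apply, Module.Basis.mk_apply]
  exact hb (σ.symm l).2

include hVaff in
/-- **Common denominators for coordinates**: for a `K(Y)`-basis `e` of `K(X)` (any finite index
type) there is `0 ≠ c ∈ Γ(V, 𝒪_Y)` such that `c · e^*_l(b) ∈ Γ(V, 𝒪_Y)` for every section
`b ∈ Γ(f⁻¹V, 𝒪_X)` and every coordinate functional `e^*_l` (`Γ(f⁻¹V)` is a finite `Γ(V)`-module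
and `K(Y) = Frac Γ(V)`; clear the denominators of the coordinates of finitely many generators).
[folklore] -/
theorem exists_denominator {ι : Type*} [Finite ι]
    (e : Module.Basis ι Y.functionField (FunctionFieldOver f)) :
    ∃ c : Γ(Y, V), c ≠ 0 ∧ ∀ (b : Γ(X, f ⁻¹ᵁ V)) (l : ι), ∃ a : Γ(Y, V),
      ofSection hV a = ofSection hV c * e.coord l (ofPreimageSection f hV b) := by
  classical
  haveI : Nonempty V := ⟨⟨_, hV⟩⟩
  haveI := functionField_isFractionRing_of_isAffineOpen (X := Y) V hVaff
  letI := (f.app V).hom.toAlgebra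
  have hfin : (f.app V).hom.Finite := IsFinite.finite_app f V hVaff
  haveI : Module.Finite Γ(Y, V) Γ(X, f ⁻¹ᵁ V) := hfin
  obtain ⟨G, hG⟩ := Module.finite_def.1 (inferInstance : Module.Finite Γ(Y, V) Γ(X, f ⁻¹ᵁ V))
  -- `ofSection hV = algebraMap Γ(V) K(Y)` by definition
  have eA : ∀ a : Γ(Y, V), ofSection hV a = algebraMap Γ(Y, V) Y.functionField a := fun _ => rfl
  -- clear the denominators of the coordinates of the generators
  obtain ⟨⟨c, hcM⟩, hc⟩ := IsLocalization.exist_integer_multiples_of_finite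
    (nonZeroDivisors Γ(Y, V)) (S := Y.functionField)
    (fun p : G × ι => e.coord p.2 (ofPreimageSection f hV p.1))
  refine ⟨c, nonZeroDivisors.ne_zero hcM, fun b l => ?_⟩
  have hb : b ∈ Submodule.span Γ(Y, V) (G : Set Γ(X, f ⁻¹ᵁ V)) := by rw [hG]; trivial
  induction hb using Submodule.span_induction generalizing l with
  | mem g hg =>
    obtain ⟨a, ha⟩ := hc (⟨g, hg⟩, l)
    refine ⟨a, ?_⟩
    rw [eA, ha, Algebra.smul_def, eA]
  | zero => exact ⟨0, by rw [eA, map_zero, map_zero, map_zero, mul_zero]⟩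
  | add b₁ b₂ _ _ h₁ h₂ =>
    obtain ⟨a₁, ha₁⟩ := h₁ l
    obtain ⟨a₂, ha₂⟩ := h₂ l
    refine ⟨a₁ + a₂, ?_⟩
    rw [eA] at ha₁ ha₂ ⊢
    rw [map_add, ha₁, ha₂, map_add, map_add, mul_add]
  | smul r b _ h =>
    obtain ⟨a, ha⟩ := h l
    refine ⟨r * a, ?_⟩
    have e1 : ofPreimageSection f hV (r • b) = ofSection hV r • ofPreimageSection f hV b := by
      rw [Algebra.smul_def, RingHom.algebraMap_toAlgebra (f.app V).hom, map_mul,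
        ofPreimageSection_app, Algebra.smul_def]
    rw [e1, LinearMap.map_smul, smul_eq_mul, eA (r * a), map_mul, ← eA r, ← eA a, ha]
    ring

end Basis

/-! ### Regularity of coordinates -/

section Coord

variable [IsFinite f] {W : Y.Opens} (hWaff : IsAffineOpen W) (hW : genericPoint Y ∈ W)
  {ι : Type*} (e : Module.Basis ι Y.functionField (FunctionFieldOver f)) {c : Γ(Y, W)}
  (hc : ∀ (b : Γ(X, f ⁻¹ᵁ W)) (l : ι), ∃ a : Γ(Y, W),
    ofSection hW a = ofSection hW c * e.coord l (ofPreimageSection f hW b))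

include hWaff hc in
/-- **Coordinates of functions regular over a principal open**: if `β ∈ K(X)` is regular at every
point of `f⁻¹D(c')` for `0 ≠ c' ∈ Γ(W, 𝒪_Y)` (`W` affine), then `c'^N · c · e^*_l(β) ∈ Γ(W, 𝒪_Y)`
for some `N` — since `f⁻¹D(c') = D(f^*c')` in the affine `f⁻¹W` and `Γ(D(f^*c'), 𝒪_X) =
Γ(f⁻¹W, 𝒪_X)_{c'}` (Görtz–Wedhorn I, (2.10.1)), `c'^N β` comes from `Γ(f⁻¹W, 𝒪_X)`, whose
coordinates have denominator `c`. [folklore] -/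
theorem exists_pow_mul_coord_eq {c' : Γ(Y, W)} (hc' : genericPoint Y ∈ Y.basicOpen c')
    {β : X.functionField} (hβ : ∀ x ∈ f ⁻¹ᵁ Y.basicOpen c', IsRegularAt x β) (l : ι) :
    ∃ (N : ℕ) (a : Γ(Y, W)),
      ofSection hW c' ^ N * (ofSection hW c * e.coord l (of f β)) = ofSection hW a := by
  have hWX : IsAffineOpen (f ⁻¹ᵁ W) := hWaff.preimage f
  have hWξ : genericPoint X ∈ f ⁻¹ᵁ W := genericPoint_mem_preimage f hW
  -- `f⁻¹ D(c') = D(f^* c')` and `η_X` lies in it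
  rw [Scheme.preimage_basicOpen] at hβ
  have hc'0 : ofSection hW c' ≠ 0 := (genericPoint_mem_basicOpen_iff hW c').1 hc'
  have hfc' : ofSection hWξ (f.app W c') = functionFieldMap f (ofSection hW c') :=
    (functionFieldMap_ofSection f hW c').symm
  have hξ' : genericPoint X ∈ X.basicOpen (f.app W c') := by
    rw [genericPoint_mem_basicOpen_iff hWξ, hfc']
    exact (map_ne_zero _).2 hc'0
  -- so `(f^* c')^N β ∈ Γ(f⁻¹W, 𝒪_X)`
  obtain ⟨N, b, hb⟩ := exists_pow_mul_eq_ofSection hWX (f.app W c') hξ' hβ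
  obtain ⟨a, ha⟩ := hc b l
  refine ⟨N, a, ?_⟩
  -- read `hb` in `K(X)/K(Y)`: `c'^N • β = ψ b`
  have hb' : (ofSection hW c' ^ N) • of f β = ofPreimageSection f hW b := by
    rw [ofPreimageSection_apply, ← hb, map_mul, map_pow, Algebra.smul_def, map_pow, algebraMap_apply,
      ← hfc']
  rw [ha, ← hb', LinearMap.map_smul, smul_eq_mul]
  ring

include hWaff hc in
/-- **Coordinates of regular functions are regular**: if `β ∈ K(X)` is regular at every point of
`f⁻¹(W ∩ V)` then `c · e^*_l(β)` is regular at every point of `W ∩ V` (cover `W ∩ V` by principal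
opens `D(c')` of the affine `W` and use `exists_pow_mul_coord_eq`: `c e^*_l(β) = a / c'^N` with
`c'` a unit near the point). [folklore] -/
theorem isRegularAt_coord_of_forall_isRegularAt {V : Y.Opens} {β : X.functionField}
    (hβ : ∀ x ∈ f ⁻¹ᵁ (W ⊓ V), IsRegularAt x β) (l : ι) {y : Y} (hyW : y ∈ W) (hyV : y ∈ V) :
    IsRegularAt y (ofSection hW c * e.coord l (of f β)) := by
  obtain ⟨c', hc'le, hyc'⟩ := hWaff.exists_basicOpen_le (V := W ⊓ V) ⟨y, hyW, hyV⟩ hyW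
  have hξc' : genericPoint Y ∈ Y.basicOpen c' := genericPoint_mem_of_mem hyc'
  have hβ' : ∀ x ∈ f ⁻¹ᵁ Y.basicOpen c', IsRegularAt x β := fun x hx =>
    hβ x (show f x ∈ W ⊓ V from hc'le hx)
  obtain ⟨N, a, hNa⟩ := exists_pow_mul_coord_eq f hWaff hW e hc hξc' hβ' l
  have hu : IsUnitAt y (ofSection hW c') :=
    (isUnitAt_ofSection_iff (Y.basicOpen_le c' hyc') c').2 hyc'
  have e1 : ofSection hW c * e.coord l (of f β) =
      ((ofSection hW c') ^ N)⁻¹ * ofSection hW a := by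
    rw [← hNa, ← mul_assoc, inv_mul_cancel₀ (pow_ne_zero N hu.ne_zero), one_mul]
  rw [e1]
  exact (hu.pow N).inv.isRegularAt.mul (isRegularAt_ofSection (Y.basicOpen_le c' hyc') a)

end Coord

end FunctionFieldOver

end Literature.AlgebraicGeometry.Motives

end
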